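import Mathlib.Data.Real.Basic
import Literature.Computability.AlgebraicComplexity.NonCommutativeRank
import Literature.Computability.AlgebraicComplexity.EGOW2018RankMeasures
import HarnessLib

/-!
# Derksen–Makam: linear matrices with `ncrk / rk → 2`, and [EGOW18, §6]: `hrk ≥ (2 − ε) · rk`
# (Conjecture 6.1 at `d = 1`)

Sources.
* [DM16] H. Derksen, V. Makam, *On non-commutative rank and tensor rank*, Linear Multilinear
  Algebra 66 (2018) 1069–1084 = arXiv:1606.06701 (`lit read arxiv:1606.06701`, chunks p0003–p0004 =
  §1, p0009 = §4). Bib key `DerksenMakam2018` (cited as [DM16] by [EGOW18]).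
* [EGOW18] K. Efremenko, A. Garg, R. Oliveira, A. Wigderson, ITCS 2018 = arXiv:1710.09502, §6 p. 17,
  bullet 4 before Conjecture 6.1 (chunk p0017.txt:L20–23). Bib key `EfremenkoGargOliveiraWigderson2018`.
* [BJP18] M. Bläser, G. Jindal, A. Pandey, Theory of Computing 14 (2018), Thm 2.7 (p. 5).
* [Landsberg2015] J. M. Landsberg, J. Pure Appl. Algebra 219 (2015) — the source of [DM16, Prop 4.6].

Content (cell val-lit, typer t22: the one statement of [EGOW18] left untyped by rows EGOW2018-A and
EGOW2018-B, with the result of [DM16] it quotes). The non-commutative rank `ncRank` (shrunk-subspace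
form) and the blow-ups are in `Literature/Computability/AlgebraicComplexity/NonCommutativeRank.lean`.
1. `matrixSetRank_le_ncRank`: `rk(𝓑) ≤ ncrk(𝓑)` ([BJP18, Lemma 2.6]; `rk(𝓑)` = tree `matrixSetRank`).
2. THE BRIDGE used silently in [EGOW18, §6]: for a LINEAR matrix `M(x) = ∑ xₗ Bₗ` (tree
   `genericCombination`) the homogeneous rank of [EGOW18, Def 3.1] (tree `homogRank`) EQUALS
   `ncRank {Bₗ}` — `homogRank_genericCombination_eq_ncRank`, PROVED over every field (both
   inequalities: a cover `(U, W)` gives a `(0,1)/(1,0)`-bidegree decomposition and conversely).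
   Consequence: `ncrk ≤ 2 · rk` over infinite fields ([BJP18, Thm 2.7] = [FR04]) is the `d = 1` case
   of the tree's `EGOW2018_lem33`.
3. [DM16, §4]: the exterior-multiplication matrices `L_v : Λ^p K^n → Λ^{p+1} K^n`, `w ↦ v ∧ w`, written
   on the basis of `p`-subsets as explicit signed incidence matrices (`extMulMatrix` = `L_{eᵢ}`,
   `extMulVec` = `L_v`), the space `𝒳(p,n) = span{L_{eᵢ}}` (`dmSpace`) and the linear matrix
   `A(p,n) = ∑ tᵢ L_{eᵢ}` (`dmLinearMatrix`). PROVED: `L_v ∘ L_v = 0`; [DM16, Cor 4.4]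
   `rk L_v = C(n−1,p)` for `v ≠ 0` over EVERY field (diagonal minor + rank–nullity, replacing the
   paper's change of basis); [DM16, Cor 4.5] `crk A(p,n) = rk 𝒳(p,n) = C(n−1,p)`.
   NAMED FACTS (characteristic `0`, as in [DM16, §4]): [DM16, Prop 4.6] = [Landsberg2015] (the
   Toeplitz blow-up `∑ L_{eᵢ} ⊗ S_{i−p}` of `𝒳(p,2p+1)` has full rank) — the single external input —
   and [DM16, Thm 1.15] as printed (`ncrk 𝒳(p,2p+1) / rk 𝒳(p,2p+1) = (2p+1)/(p+1)`); PROVED: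
   Cor 4.7 and Thm 1.15 from Prop 4.6, and Thm 1.15 ⟺ "`ncrk 𝒳(p,2p+1) = C(2p+1,p)`".
4. [EGOW18, §6 bullet 4] «there exists a linear matrix `M(x)` of rank `r` whose homogeneous rank is
   lower bounded by `(2 − ε) r`» TYPED (`EGOW2018_sec6_derksenMakam`, with `0 < r` against vacuity)
   and PROVED from [DM16, Thm 1.15] (all `p`), together with the `d = 1` instance of
   [EGOW18, Conj 6.1] in the exact clause shape of the Summits conjecture leaf `EGOW2018_conj61Over`
   (which is neither imported nor asserted): `EGOW2018_conj61_degOne_of_thm_1_15`.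

5. UNCONDITIONAL instance `p = 1` ([DM16, Example 1.1] / [DM16, Cor 1.16(1)] at `i = 1`): `ncrk 𝒳(1,n) = n`
   for `n ≥ 3` over every field (`ncRank_dmSpace_one`), hence [DM16, Thm 1.15] at `p = 1`
   (`DerksenMakam2018_thm_1_15_one`) and a kernel-checked `3 × 3` linear matrix with
   `rk_{F(x)} = 2 < 3 = hrk` (`EGOW2018_sec6_linearMatrix_hrk_three_rk_two`).

Honest framing: context for the val-lit GAP row N5 (Conjecture 6.1 is KNOWN at `d = 1`, conditional
here only on the published [DM16, Thm 1.15]); nothing in this file bears on `VP ≠ VNP`.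
Not typed: [DM16] Lemma 4.1 / Remark 4.2 / Cor 4.3 (a basis ordering exhibiting a block form; its
content is the complex `L_v ∘ L_v = 0` and the diagonal minor proved here), Cor 1.16 (other
`𝒳(i,n)`), §1.2 Props 1.11–1.13 / Thm 1.14, §2–§3, §5 (regularity lemma, rational identities,
border rank) — not used by [EGOW18].
-/

open MvPolynomial

namespace Literature.Computability.AlgebraicComplexity

/-! ## 1. Commutative rank ≤ non-commutative rank -/

section NcRank

variable {F : Type*} [Field F] {ι κ : Type*} [Fintype κ]

/-- **Commutative rank ≤ non-commutative rank**: `rk(𝓑) ≤ ncrk(𝓑)` with `rk(𝓑)` the maximal rank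
of a member ([BJP18, Def 2.2] = tree `matrixSetRank`, [EGOW18, Def 2.5]).
[cite: BlaeserJindalPandey2018, Lemma 2.6, p. 5] locator: paper:doi-10-4086-toc-2018-v014a003 p0005.txt:L25 -/
theorem matrixSetRank_le_ncRank [Fintype ι] (𝓑 : Set (Matrix ι κ F)) : matrixSetRank 𝓑 ≤ ncRank 𝓑 :=
  matrixSetRank_le fun _ hB => rank_le_ncRank hB

end NcRank

/-! ## 2. Linear matrices: homogeneous rank = non-commutative rank (the bridge behind [EGOW18, §6]) -/

section LinearMatrices

variable {F : Type*} [Field F] {ι κ : Type*} {n : ℕ}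

/-- Entries of the linear matrix `∑ₗ xₗ Bₗ` of a family of constant matrices (tree
`genericCombination`, [EGOW18, Prop 2.6]; [DM16, §1.1] "linear matrix `t₁X₁ + ⋯ + t_m X_m`").
[cite: DerksenMakam2018, §1.1–1.2, p. 3] locator: paper:arxiv-1606.06701 p0003.txt:L5 -/
theorem genericCombination_apply (B : Fin n → Matrix ι κ F) (i : ι) (j : κ) :
    genericCombination B i j = ∑ l, MvPolynomial.X l * C (B l i j) := by
  simp [genericCombination, Matrix.sum_apply, Matrix.smul_apply, Matrix.map_apply, smul_eq_mul]

/-- The entries of `∑ₗ xₗ Bₗ` are homogeneous of degree `1` (a "linear matrix", [DM16, §1.1]).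
[cite: DerksenMakam2018, §1.1, p. 3] locator: paper:arxiv-1606.06701 p0003.txt:L5 -/
theorem isHomogeneous_genericCombination (B : Fin n → Matrix ι κ F) (i : ι) (j : κ) :
    (genericCombination B i j).IsHomogeneous 1 := by
  rw [genericCombination_apply]
  refine IsHomogeneous.sum _ _ _ fun l _ => ?_
  simpa using (isHomogeneous_X F l).mul (isHomogeneous_C (Fin n) (B l i j))

/-- The coefficient matrix of `xₗ` in `∑ₗ xₗ Bₗ` is `Bₗ` ([DM16, Lemma 1.4]: the space of the linear
matrix is `span(X₁, …, X_m)`). [cite: DerksenMakam2018, Lemma 1.4, p. 3] locator: paper:arxiv-1606.06701 p0003.txt:L52 -/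
theorem coeff_single_genericCombination (B : Fin n → Matrix ι κ F) (l : Fin n) (i : ι) (j : κ) :
    coeff (Finsupp.single l 1) (genericCombination B i j) = B l i j := by
  classical
  rw [genericCombination_apply, coeff_sum, Finset.sum_eq_single l]
  · rw [mul_comm, C_mul_X_eq_monomial, coeff_monomial, if_pos rfl]
  · intro l' _ hl'
    rw [mul_comm, C_mul_X_eq_monomial, coeff_monomial, if_neg]
    exact fun h => hl' (Finsupp.single_left_injective one_ne_zero h)
  · exact fun h => absurd (Finset.mem_univ l) h

/-- A polynomial homogeneous of degree `1` is the linear form `∑ₗ (coeff xₗ) · xₗ`.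
[cite: DerksenMakam2018, §1.1, p. 3] locator: paper:arxiv-1606.06701 p0003.txt:L5 -/
theorem eq_sum_X_mul_C_coeff_of_isHomogeneous_one {φ : MvPolynomial (Fin n) F}
    (hφ : φ.IsHomogeneous 1) : φ = ∑ l, MvPolynomial.X l * C (coeff (Finsupp.single l 1) φ) := by
  classical
  have hmem : φ ∈ Submodule.span F (Set.range (MvPolynomial.X : Fin n → MvPolynomial (Fin n) F)) := by
    rw [← homogeneousSubmodule_one_eq_span_X]
    exact hφ
  obtain ⟨c, hc⟩ := (Submodule.mem_span_range_iff_exists_fun F).1 hmem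
  have hcoeff : ∀ l, coeff (Finsupp.single l 1) φ = c l := by
    intro l
    rw [← hc, coeff_sum, Finset.sum_eq_single l]
    · rw [smul_eq_C_mul, C_mul_X_eq_monomial, coeff_monomial, if_pos rfl]
    · intro l' _ hl'
      rw [smul_eq_C_mul, C_mul_X_eq_monomial, coeff_monomial, if_neg]
      exact fun h => hl' (Finsupp.single_left_injective one_ne_zero h)
    · exact fun h => absurd (Finset.mem_univ l) h
  conv_lhs => rw [← hc]
  exact Finset.sum_congr rfl fun l _ => by rw [hcoeff, smul_eq_C_mul, mul_comm]

/-- **Every linear matrix is `∑ₗ xₗ Bₗ` with `Bₗ` its coefficient matrices** (so the statements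
below about `genericCombination` cover all matrices with homogeneous degree-`1` entries,
[DM16, §1.1–1.2]). [cite: DerksenMakam2018, Lemma 1.4, p. 3] locator: paper:arxiv-1606.06701 p0003.txt:L52 -/
theorem eq_genericCombination_of_isHomogeneous_one (M : Matrix ι κ (MvPolynomial (Fin n) F))
    (hM : ∀ i j, (M i j).IsHomogeneous 1) :
    M = genericCombination fun l => M.map (coeff (Finsupp.single l 1)) := by
  refine Matrix.ext fun i j => ?_
  rw [genericCombination_apply]
  exact eq_sum_X_mul_C_coeff_of_isHomogeneous_one (hM i j)

variable [Fintype ι] [DecidableEq ι]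

/-- **`hrk(∑ₗ xₗ Bₗ) ≤ ncrk{Bₗ}`**: a cover `(U, W)` of the matrix space (`Bₗ W ⊆ U` for all `l`,
`F^ι = W ⊕ W'`) yields the homogeneous rank-one decomposition
`∑ₗ xₗ Bₗ = ∑_{k ≤ dim U} u_k ⊗ (linear) + ∑_{k ≤ dim W'} (linear) ⊗ w'_k*` of [EGOW18, Def 3.1] with
`dim U + codim W` terms. [cite: EfremenkoGargOliveiraWigderson2018, §6 and Def 3.1, p. 17] locator: paper:arxiv-1710.09502 p0017.txt:L20 -/
theorem homogRank_genericCombination_le_ncRank (B : Fin n → Matrix ι ι F) :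
    homogRank (genericCombination B) ≤ ncRank (Set.range B) := by
  obtain ⟨U, W, hUW, hcost⟩ := exists_cover_eq_ncRank (Set.range B)
  obtain ⟨W', hc⟩ := W.exists_isCompl
  set a := Module.finrank F U
  set b := Module.finrank F W'
  let bU := Module.finBasis F U
  let bW := Module.finBasis F W'
  let P := W.projection W' hc
  let P' := W'.projection W hc.symm
  let e : ι → ι → F := fun j => Pi.single j 1
  have hTU : ∀ l x, (B l).mulVecLin (P x) ∈ U :=
    fun l x => hUW (B l) ⟨l, rfl⟩ ⟨P x, Submodule.projection_apply_mem hc x, rfl⟩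
  let α : Fin n → Fin a → ι → F := fun l k j => bU.repr ⟨(B l).mulVecLin (P (e j)), hTU l (e j)⟩ k
  let δ : Fin b → ι → F := fun k j => bW.repr ⟨P' (e j), Submodule.projection_apply_mem hc.symm _⟩ k
  -- the key identity: `Bₗ[i,j] = ∑ₖ αₗₖ(j) uₖ(i) + ∑ₖ δₖ(j) (Bₗ w'ₖ)(i)`
  have hstar : ∀ l i j, B l i j = ∑ k, α l k j * (bU k : ι → F) i +
      ∑ k, δ k j * ((B l).mulVec (bW k : ι → F)) i := by
    intro l i j
    have h1 : B l i j = (B l).mulVecLin (e j) i := by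
      rw [Matrix.mulVecLin_apply, Matrix.mulVec_single_one]; rfl
    have h2 : (B l).mulVecLin (e j) = (B l).mulVecLin (P (e j)) + (B l).mulVecLin (P' (e j)) := by
      rw [← map_add, Submodule.projection_add_projection_eq_self hc]
    have h3 : (B l).mulVecLin (P (e j)) = ∑ k, α l k j • (bU k : ι → F) := by
      have := bU.sum_repr ⟨(B l).mulVecLin (P (e j)), hTU l (e j)⟩
      rw [Subtype.ext_iff, Submodule.coe_sum] at this
      simpa only [Submodule.coe_smul] using this.symm
    have h4 : P' (e j) = ∑ k, δ k j • (bW k : ι → F) := by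
      have := bW.sum_repr ⟨P' (e j), Submodule.projection_apply_mem hc.symm _⟩
      rw [Subtype.ext_iff, Submodule.coe_sum] at this
      simpa only [Submodule.coe_smul] using this.symm
    have h5 : (B l).mulVecLin (P' (e j)) = ∑ k, δ k j • (B l).mulVec (bW k : ι → F) := by
      rw [h4, map_sum]
      simp only [map_smul, Matrix.mulVecLin_apply]
    rw [h1, h2, h3, h5, Pi.add_apply, Finset.sum_apply, Finset.sum_apply]
    simp only [Pi.smul_apply, smul_eq_mul]
  -- the homogeneous decomposition with `a + b` terms
  let u' : Fin a ⊕ Fin b → ι → MvPolynomial (Fin n) F := fun s => match s with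
    | Sum.inl k => fun i => C ((bU k : ι → F) i)
    | Sum.inr k => fun i => ∑ l, C (((B l).mulVec (bW k : ι → F)) i) * MvPolynomial.X l
  let v' : Fin a ⊕ Fin b → ι → MvPolynomial (Fin n) F := fun s => match s with
    | Sum.inl k => fun j => ∑ l, C (α l k j) * MvPolynomial.X l
    | Sum.inr k => fun j => C (δ k j)
  let du : Fin a ⊕ Fin b → ℕ := fun s => match s with | Sum.inl _ => 0 | Sum.inr _ => 0 + 1
  let dv : Fin a ⊕ Fin b → ℕ := fun s => match s with | Sum.inl _ => 0 + 1 | Sum.inr _ => 0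
  have hu : ∀ s i, (u' s i).IsHomogeneous (du s) := by
    rintro (k | k) i
    · exact isHomogeneous_C _ _
    · exact IsHomogeneous.sum _ _ _ fun l _ => (isHomogeneous_C _ _).mul (isHomogeneous_X F l)
  have hv : ∀ s j, (v' s j).IsHomogeneous (dv s) := by
    rintro (k | k) j
    · exact IsHomogeneous.sum _ _ _ fun l _ => (isHomogeneous_C _ _).mul (isHomogeneous_X F l)
    · exact isHomogeneous_C _ _
  have hdec : genericCombination B = ∑ s, Matrix.vecMulVec (u' s) (v' s) := by
    refine Matrix.ext fun i j => ?_
    rw [Matrix.sum_apply, Fintype.sum_sum_type, genericCombination_apply]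
    simp only [Matrix.vecMulVec_apply, u', v']
    simp_rw [hstar]
    simp only [map_add, map_sum, map_mul, mul_add, Finset.sum_add_distrib, Finset.mul_sum,
      Finset.sum_mul]
    congr 1
    · rw [Finset.sum_comm]
      exact Finset.sum_congr rfl fun k _ => Finset.sum_congr rfl fun l _ => by ring
    · rw [Finset.sum_comm]
      exact Finset.sum_congr rfl fun k _ => Finset.sum_congr rfl fun l _ => by ring
  calc homogRank (genericCombination B) ≤ Fintype.card (Fin a ⊕ Fin b) :=
        homogRank_le_card _ u' v' du dv hu hv hdec
    _ = a + b := by simp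
    _ = ncRank (Set.range B) := by
        rw [← hcost, add_comm, (Submodule.quotientEquivOfIsCompl W W' hc).finrank_eq]

/-- A polynomial homogeneous of degree `0` is the constant `C (coeff 0 φ)`.
[cite: EfremenkoGargOliveiraWigderson2018, Def 2.2, p. 8] locator: paper:arxiv-1710.09502 p0008.txt:L60 -/
theorem eq_C_coeff_zero_of_isHomogeneous_zero {σ : Type*} {φ : MvPolynomial σ F}
    (hφ : φ.IsHomogeneous 0) : φ = C (coeff 0 φ) :=
  totalDegree_eq_zero_iff_eq_C.1 ((totalDegree_zero_iff_isHomogeneous _).2 hφ)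

/-- **`ncrk{Bₗ} ≤ hrk(∑ₗ xₗ Bₗ)`**: in a homogeneous rank-one decomposition of a LINEAR matrix only
the terms of bidegree `(0,1)` and `(1,0)` survive in degree `1`; the constant column vectors of the
`(0,1)` terms span `U`, the constant row vectors of the `(1,0)` terms cut out `W`, and every `Bₗ`
maps `W` into `U` — a cover of cost `≤` the number of terms.
[cite: EfremenkoGargOliveiraWigderson2018, §6 and Def 3.1, p. 17] locator: paper:arxiv-1710.09502 p0017.txt:L20 -/
theorem ncRank_range_le_homogRank_genericCombination (B : Fin n → Matrix ι ι F) :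
    ncRank (Set.range B) ≤ homogRank (genericCombination B) := by
  classical
  obtain ⟨u, v, du, dv, hu, hv, hM⟩ :=
    exists_decomposition_card_eq_homogRank (genericCombination B) (isHomogeneous_genericCombination B)
  let A : Finset (Fin (homogRank (genericCombination B))) :=
    Finset.univ.filter fun k => du k = 0 ∧ dv k = 1
  let Bs : Finset (Fin (homogRank (genericCombination B))) :=
    Finset.univ.filter fun k => du k = 1 ∧ dv k = 0
  let uc : Fin (homogRank (genericCombination B)) → ι → F := fun k i => coeff 0 (u k i)
  let vc : Fin (homogRank (genericCombination B)) → ι → F := fun k j => coeff 0 (v k j)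
  let U : Submodule F (ι → F) := Submodule.span F (Set.range fun k : A => uc k)
  let Φ : (ι → F) →ₗ[F] (Bs → F) := (Matrix.of fun (k : Bs) j => vc k j).mulVecLin
  let W : Submodule F (ι → F) := LinearMap.ker Φ
  -- the coefficient of `x_l` in `u_k(i) v_k(j)`
  have hcoef : ∀ l k i j, coeff (Finsupp.single l 1) (u k i * v k j) =
      (if k ∈ A then uc k i * coeff (Finsupp.single l 1) (v k j) else 0) +
        (if k ∈ Bs then coeff (Finsupp.single l 1) (u k i) * vc k j else 0) := by
    intro l k i j
    by_cases hA : k ∈ A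
    · have hA' := (Finset.mem_filter.1 hA).2
      have hB : k ∉ Bs := fun h => by have := (Finset.mem_filter.1 h).2; omega
      rw [if_pos hA, if_neg hB, add_zero]
      have h0 : (u k i).IsHomogeneous 0 := hA'.1 ▸ hu k i
      conv_lhs => rw [eq_C_coeff_zero_of_isHomogeneous_zero h0, coeff_C_mul]
    · by_cases hB : k ∈ Bs
      · have hB' := (Finset.mem_filter.1 hB).2
        rw [if_neg hA, if_pos hB, zero_add]
        have h0 : (v k j).IsHomogeneous 0 := hB'.2 ▸ hv k j
        conv_lhs => rw [eq_C_coeff_zero_of_isHomogeneous_zero h0, mul_comm, coeff_C_mul, mul_comm]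
      · rw [if_neg hA, if_neg hB, add_zero]
        have hne : (Finsupp.single l 1 : Fin n →₀ ℕ).degree ≠ du k + dv k := by
          rw [Finsupp.degree_single]
          intro h
          have hA2 : ¬ (du k = 0 ∧ dv k = 1) := fun h' => hA (Finset.mem_filter.2 ⟨Finset.mem_univ _, h'⟩)
          have hB2 : ¬ (du k = 1 ∧ dv k = 0) := fun h' => hB (Finset.mem_filter.2 ⟨Finset.mem_univ _, h'⟩)
          omega
        exact ((hu k i).mul (hv k j)).coeff_eq_zero hne
  -- entries of `B_l` through the decomposition
  have hentry : ∀ l i j, B l i j = ∑ k ∈ A, uc k i * coeff (Finsupp.single l 1) (v k j) +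
      ∑ k ∈ Bs, coeff (Finsupp.single l 1) (u k i) * vc k j := by
    intro l i j
    have hij : genericCombination B i j = (∑ k, Matrix.vecMulVec (u k) (v k)) i j :=
      congr_fun (congr_fun hM i) j
    rw [← coeff_single_genericCombination B l i j, hij, Matrix.sum_apply]
    simp only [Matrix.vecMulVec_apply, coeff_sum, hcoef, Finset.sum_add_distrib, Finset.sum_ite_mem,
      Finset.univ_inter]
  -- the cover property
  have hcover : ∀ M ∈ Set.range B, W.map M.mulVecLin ≤ U := by
    rintro _ ⟨l, rfl⟩ _ ⟨w, hw, rfl⟩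
    have hw' : ∀ k ∈ Bs, ∑ j, vc k j * w j = 0 := by
      intro k hk
      have := congr_fun (LinearMap.mem_ker.1 hw) ⟨k, hk⟩
      simpa [Φ, Matrix.mulVecLin_apply, Matrix.mulVec, dotProduct] using this
    have hBw : (B l).mulVecLin w = ∑ k ∈ A, (∑ j, coeff (Finsupp.single l 1) (v k j) * w j) • uc k := by
      funext i
      rw [Matrix.mulVecLin_apply, Finset.sum_apply]
      simp only [Matrix.mulVec, dotProduct, Pi.smul_apply, smul_eq_mul, hentry, add_mul,
        Finset.sum_add_distrib, Finset.sum_mul]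
      rw [Finset.sum_comm, Finset.sum_comm (s := Finset.univ) (t := Bs)]
      have h0 : ∑ k ∈ Bs, ∑ j, coeff (Finsupp.single l 1) (u k i) * vc k j * w j = 0 := by
        refine Finset.sum_eq_zero fun k hk => ?_
        simp_rw [mul_assoc, ← Finset.mul_sum, hw' k hk, mul_zero]
      rw [h0, add_zero]
      exact Finset.sum_congr rfl fun k _ => Finset.sum_congr rfl fun j _ => by ring
    rw [hBw]
    exact U.sum_mem fun k hk => U.smul_mem _ (Submodule.subset_span ⟨⟨k, hk⟩, rfl⟩)
  -- counting
  have hU : Module.finrank F U ≤ A.card := (finrank_range_le_card _).trans (by simp)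
  have hW : Module.finrank F ((ι → F) ⧸ W) ≤ Bs.card := by
    rw [(LinearMap.quotKerEquivRange Φ).finrank_eq]
    exact (Submodule.finrank_le _).trans (by simp)
  have hAB : A.card + Bs.card ≤ homogRank (genericCombination B) := by
    rw [← Finset.card_union_of_disjoint]
    · exact (Finset.card_le_univ _).trans (by simp)
    · exact Finset.disjoint_filter.2 fun k _ h h' => by omega
  calc ncRank (Set.range B) ≤ Module.finrank F ((ι → F) ⧸ W) + Module.finrank F U :=
        ncRank_le_of_cover _ U W hcover
    _ ≤ Bs.card + A.card := Nat.add_le_add hW hU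
    _ ≤ homogRank (genericCombination B) := by omega

/-- **THE BRIDGE: for a linear matrix, homogeneous rank ([EGOW18, Def 3.1]) = non-commutative rank
of its matrix space (shrunk-subspace form).** This is the identification used without comment in
[EGOW18, §6] when the ncrk-theorem of [DM16] is quoted as a statement about `hrk`; it holds over
every field. [cite: EfremenkoGargOliveiraWigderson2018, §6, p. 17] locator: paper:arxiv-1710.09502 p0017.txt:L20 -/
theorem homogRank_genericCombination_eq_ncRank (B : Fin n → Matrix ι ι F) :
    homogRank (genericCombination B) = ncRank (Set.range B) :=
  le_antisymm (homogRank_genericCombination_le_ncRank B) (ncRank_range_le_homogRank_genericCombination B)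

/-- The bridge for an arbitrary linear matrix `M(x)`: `hrk(M) = ncrk{coefficient matrices of M}`.
[cite: EfremenkoGargOliveiraWigderson2018, §6, p. 17] locator: paper:arxiv-1710.09502 p0017.txt:L20 -/
theorem homogRank_eq_ncRank_of_isHomogeneous_one (M : Matrix ι ι (MvPolynomial (Fin n) F))
    (hM : ∀ i j, (M i j).IsHomogeneous 1) :
    homogRank M = ncRank (Set.range fun l => M.map (coeff (Finsupp.single l 1))) := by
  conv_lhs => rw [eq_genericCombination_of_isHomogeneous_one M hM]
  exact homogRank_genericCombination_eq_ncRank _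

/-- **`ncrk ≤ 2 · rk` over infinite fields ([BJP18, Thm 2.7] = [FR04]; [DM16, Prop 1.11] has `<`)**,
obtained here as the `d = 1` case of [EGOW18, Lemma 3.3] (`hrk ≤ 2 · rk_{F(x)}`, tree
`EGOW2018_lem33`) through the bridge and [EGOW18, Prop 2.6] (`rk_{F(x)}(∑ xₗBₗ) = rk(span Bₗ)`).
[cite: BlaeserJindalPandey2018, Thm 2.7, p. 5] locator: paper:doi-10-4086-toc-2018-v014a003 p0005.txt:L33 -/
theorem ncRank_le_two_mul_matrixSetRank [Infinite F] (B : Fin n → Matrix ι ι F) :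
    ncRank (Set.range B) ≤ 2 * matrixSetRank (Submodule.span F (Set.range B) : Set (Matrix ι ι F)) := by
  rw [← homogRank_genericCombination_eq_ncRank, EGOW2018_prop26, mul_comm]
  exact EGOW2018_lem33 _ (isHomogeneous_genericCombination B) le_rfl

end LinearMatrices

/-! ## 3. [DM16, §4]: the exterior-multiplication spaces `𝒳(p,n)` and the linear matrices `A(p,n)` -/

section ExteriorMultiplication

/-- Index set of the standard basis `{e_{i₁} ∧ ⋯ ∧ e_{i_p} : i₁ < ⋯ < i_p}` of `Λ^p F^n`: the
`p`-subsets of `[n]` ([DM16, §4]: "a basis for `Λ^p(K^n)` is given by …"); `|ExtIdx n p| = C(n,p)`.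
[cite: DerksenMakam2018, §4, p. 9] locator: paper:arxiv-1606.06701 p0009.txt:L3 -/
abbrev ExtIdx (n p : ℕ) : Type := {s : Finset (Fin n) // s.card = p}

/-- `|ExtIdx n p| = C(n, p)`. [cite: DerksenMakam2018, §4, p. 9] locator: paper:arxiv-1606.06701 p0009.txt:L3 -/
theorem card_extIdx (n p : ℕ) : Fintype.card (ExtIdx n p) = n.choose p := by
  rw [Fintype.card_finset_len, Fintype.card_fin]

variable (R : Type*) [CommRing R]

/-- The sign in `e_i ∧ e_S = ± e_{S ∪ {i}}` (`i ∉ S`): `(-1)^{#{s ∈ S : s < i}}` (moving `e_i` past the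
smaller indices). [cite: DerksenMakam2018, §4, p. 9] locator: paper:arxiv-1606.06701 p0009.txt:L3 -/
def wedgeSign {n : ℕ} (i : Fin n) (S : Finset (Fin n)) : R :=
  (-1) ^ (S.filter (· < i)).card

/-- **[DM16, §4] the matrix of `L_{e_i} : Λ^p K^n → Λ^{p+1} K^n`, `w ↦ e_i ∧ w`**, in the bases of
`p`- and `(p+1)`-subsets: entry `(T, S) = ±1` (the sign `wedgeSign i S`) if `T = S ∪ {i}` with `i ∉ S`,
and `0` otherwise (rows `T`, columns `S`; if `i ∈ S` the condition `T = insert i S` fails by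
cardinality). [cite: DerksenMakam2018, §4, p. 9] locator: paper:arxiv-1606.06701 p0009.txt:L5 -/
def extMulMatrix (n p : ℕ) (i : Fin n) : Matrix (ExtIdx n (p + 1)) (ExtIdx n p) R :=
  Matrix.of fun T S => if T.1 = insert i S.1 then wedgeSign R i S.1 else 0

/-- **[DM16, §1.3/§4] `L_v = ∑ᵢ vᵢ L_{eᵢ}`**, the matrix of `w ↦ v ∧ w : Λ^p K^n → Λ^{p+1} K^n` (the map
`L : K^n → Hom(Λ^p K^n, Λ^{p+1} K^n)` is linear in `v`). [cite: DerksenMakam2018, §1.3, p. 4] locator: paper:arxiv-1606.06701 p0004.txt:L40 -/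
def extMulVec (n p : ℕ) (v : Fin n → R) : Matrix (ExtIdx n (p + 1)) (ExtIdx n p) R :=
  ∑ i, v i • extMulMatrix R n p i

variable {R}

/-- Entries of `L_v`. [cite: DerksenMakam2018, §4, p. 9] locator: paper:arxiv-1606.06701 p0009.txt:L5 -/
theorem extMulVec_apply {n p : ℕ} (v : Fin n → R) (T : ExtIdx n (p + 1)) (S : ExtIdx n p) :
    extMulVec R n p v T S = ∑ i, if T.1 = insert i S.1 then v i * wedgeSign R i S.1 else 0 := by
  simp only [extMulVec, Matrix.sum_apply, Matrix.smul_apply, extMulMatrix, Matrix.of_apply,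
    smul_eq_mul, mul_ite, mul_zero]

/-- `L_v` is a ring-hom image of the universal one (entries `0, ±vᵢ`).
[cite: DerksenMakam2018, §4, p. 9] locator: paper:arxiv-1606.06701 p0009.txt:L5 -/
theorem extMulVec_map {S : Type*} [CommRing S] {n p : ℕ} (f : R →+* S) (v : Fin n → R) :
    (extMulVec R n p v).map f = extMulVec S n p (f ∘ v) := by
  ext T U
  simp only [Matrix.map_apply, extMulVec_apply, map_sum]
  refine Finset.sum_congr rfl fun i _ => ?_
  split_ifs
  · simp [wedgeSign, Function.comp]
  · simp

/-- The sign rule when an index `j > i`... precisely: inserting an index `j` ABOVE `i` does not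
change `wedgeSign i`. [cite: DerksenMakam2018, §4, p. 9] locator: paper:arxiv-1606.06701 p0009.txt:L3 -/
theorem wedgeSign_insert_of_lt {n : ℕ} {i j : Fin n} (h : i < j) (S : Finset (Fin n)) :
    wedgeSign R i (insert j S) = wedgeSign R i S := by
  unfold wedgeSign
  rw [Finset.filter_insert, if_neg (not_lt.2 h.le)]

/-- Inserting an index `j` BELOW `i` (`j ∉ S`) flips `wedgeSign i`.
[cite: DerksenMakam2018, §4, p. 9] locator: paper:arxiv-1606.06701 p0009.txt:L3 -/
theorem wedgeSign_insert_of_gt {n : ℕ} {i j : Fin n} (h : j < i) {S : Finset (Fin n)} (hj : j ∉ S) :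
    wedgeSign R i (insert j S) = -wedgeSign R i S := by
  unfold wedgeSign
  rw [Finset.filter_insert, if_pos h, Finset.card_insert_of_notMem (by simp [hj]), pow_succ,
    mul_neg_one]

/-- `wedgeSign` is a unit (`±1`): its square is `1`. [cite: DerksenMakam2018, §4, p. 9] locator: paper:arxiv-1606.06701 p0009.txt:L3 -/
theorem wedgeSign_mul_self {n : ℕ} (i : Fin n) (S : Finset (Fin n)) :
    wedgeSign R i S * wedgeSign R i S = 1 := by
  rw [wedgeSign, ← pow_add, ← two_mul, pow_mul]
  simp

/-- **`L_v ∘ L_v = 0`** (`v ∧ v ∧ w = 0`): the exterior multiplication maps form a complex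
`Λ^p → Λ^{p+1} → Λ^{p+2}`; this is the relation behind the zero block of [DM16, Lemma 4.1] and the
rank count of [DM16, Cor 4.4]. [cite: DerksenMakam2018, Lemma 4.1, p. 9] locator: paper:arxiv-1606.06701 p0009.txt:L7 -/
theorem extMulVec_succ_mul_extMulVec {n p : ℕ} (v : Fin n → R) :
    extMulVec R n (p + 1) v * extMulVec R n p v = 0 := by
  classical
  ext T S
  rw [Matrix.mul_apply, Matrix.zero_apply]
  -- the coefficient of `vᵢ vⱼ`
  let f : Fin n → Fin n → R := fun i j =>
    if T.1 = insert i (insert j S.1) ∧ j ∉ S.1 then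
      v i * wedgeSign R i (insert j S.1) * (v j * wedgeSign R j S.1) else 0
  have hexp : ∀ M : ExtIdx n (p + 1), extMulVec R n (p + 1) v T M * extMulVec R n p v M S =
      ∑ i, ∑ j, if T.1 = insert i M.1 ∧ M.1 = insert j S.1 then
        v i * wedgeSign R i M.1 * (v j * wedgeSign R j S.1) else 0 := by
    intro M
    rw [extMulVec_apply, extMulVec_apply, Finset.sum_mul_sum]
    refine Finset.sum_congr rfl fun i _ => Finset.sum_congr rfl fun j _ => ?_
    split_ifs <;> simp_all
  have hsum : ∑ M : ExtIdx n (p + 1), extMulVec R n (p + 1) v T M * extMulVec R n p v M S =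
      ∑ i, ∑ j, f i j := by
    simp_rw [hexp]
    rw [Finset.sum_comm]
    refine Finset.sum_congr rfl fun i _ => ?_
    rw [Finset.sum_comm]
    refine Finset.sum_congr rfl fun j _ => ?_
    -- the sum over `M` collapses to `M = insert j S` (when `j ∉ S`)
    by_cases hj : j ∈ S.1
    · have h0 : ∀ M : ExtIdx n (p + 1), ¬ (T.1 = insert i M.1 ∧ M.1 = insert j S.1) := by
        rintro M ⟨-, hM⟩
        have := M.2
        rw [hM, Finset.insert_eq_of_mem hj, S.2] at this
        omega
      simp only [f, hj, not_true_eq_false, and_false, if_false]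
      exact Finset.sum_eq_zero fun M _ => if_neg (h0 M)
    · let M₀ : ExtIdx n (p + 1) := ⟨insert j S.1, by rw [Finset.card_insert_of_notMem hj, S.2]⟩
      rw [Finset.sum_eq_single M₀]
      · simp only [f, M₀, hj, not_false_eq_true, and_true]
      · rintro M - hM
        rw [if_neg]
        rintro ⟨-, h⟩
        exact hM (Subtype.ext h)
      · exact fun h => absurd (Finset.mem_univ _) h
  rw [hsum, ← Finset.sum_product']
  -- the summand is alternating under `(i, j) ↦ (j, i)`
  refine Finset.sum_ninvolution (fun ij => (ij.2, ij.1)) ?_ ?_ (fun _ => Finset.mem_univ _)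
    (fun _ => rfl)
  · rintro ⟨i, j⟩
    simp only [f]
    rcases lt_trichotomy i j with hij | rfl | hij
    · by_cases hc : T.1 = insert i (insert j S.1) ∧ j ∉ S.1
      · have hi : i ∉ S.1 := by
          intro hi
          have := T.2
          rw [hc.1, Finset.insert_comm, Finset.insert_eq_of_mem hi,
            Finset.card_insert_of_notMem hc.2, S.2] at this
          omega
        have hc' : T.1 = insert j (insert i S.1) ∧ i ∉ S.1 := ⟨by rw [hc.1, Finset.insert_comm], hi⟩
        rw [if_pos hc, if_pos hc', wedgeSign_insert_of_lt hij, wedgeSign_insert_of_gt hij hi]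
        ring
      · have hc' : ¬ (T.1 = insert j (insert i S.1) ∧ i ∉ S.1) := by
          rintro ⟨h1, h2⟩
          refine hc ⟨by rw [h1, Finset.insert_comm], fun hjS => ?_⟩
          have := T.2
          rw [h1, Finset.insert_comm, Finset.insert_eq_of_mem hjS,
            Finset.card_insert_of_notMem h2, S.2] at this
          omega
        rw [if_neg hc, if_neg hc', add_zero]
    · have hc : ¬ (T.1 = insert i (insert i S.1) ∧ i ∉ S.1) := by
        rintro ⟨h1, h2⟩
        have := T.2
        rw [h1, Finset.insert_idem, Finset.card_insert_of_notMem h2, S.2] at this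
        omega
      rw [if_neg hc, add_zero]
    · by_cases hc : T.1 = insert i (insert j S.1) ∧ j ∉ S.1
      · have hi : i ∉ S.1 := by
          intro hi
          have := T.2
          rw [hc.1, Finset.insert_comm, Finset.insert_eq_of_mem hi,
            Finset.card_insert_of_notMem hc.2, S.2] at this
          omega
        have hc' : T.1 = insert j (insert i S.1) ∧ i ∉ S.1 := ⟨by rw [hc.1, Finset.insert_comm], hi⟩
        rw [if_pos hc, if_pos hc', wedgeSign_insert_of_gt hij hc.2, wedgeSign_insert_of_lt hij]
        ring
      · have hc' : ¬ (T.1 = insert j (insert i S.1) ∧ i ∉ S.1) := by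
          rintro ⟨h1, h2⟩
          refine hc ⟨by rw [h1, Finset.insert_comm], fun hjS => ?_⟩
          have := T.2
          rw [h1, Finset.insert_comm, Finset.insert_eq_of_mem hjS,
            Finset.card_insert_of_notMem h2, S.2] at this
          omega
        rw [if_neg hc, if_neg hc', add_zero]
  · rintro ⟨i, j⟩ hne
    simp only [ne_eq, Prod.mk.injEq, not_and]
    intro hji
    subst hji
    exfalso
    apply hne
    simp only [f]
    rw [if_neg]
    rintro ⟨h1, h2⟩
    have := T.2
    rw [h1, Finset.insert_idem, Finset.card_insert_of_notMem h2, S.2] at this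
    omega

variable {K : Type*} [Field K]

/-- **Rank–nullity through the complex**: `rk L_v^{(p+1)} + rk L_v^{(p)} ≤ C(n, p+1)` (the image of
`L_v^{(p)}` lies in the kernel of `L_v^{(p+1)}`). [cite: DerksenMakam2018, Cor 4.4 (proof), p. 9] locator: paper:arxiv-1606.06701 p0009.txt:L52 -/
theorem rank_extMulVec_succ_add_rank_le {n p : ℕ} (v : Fin n → K) :
    (extMulVec K n (p + 1) v).rank + (extMulVec K n p v).rank ≤ n.choose (p + 1) := by
  have hcomp : (extMulVec K n (p + 1) v).mulVecLin ∘ₗ (extMulVec K n p v).mulVecLin = 0 := by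
    rw [← Matrix.mulVecLin_mul, extMulVec_succ_mul_extMulVec, Matrix.mulVecLin_zero]
  have hle := Submodule.finrank_mono (LinearMap.range_le_ker_iff.2 hcomp)
  have hrn := LinearMap.finrank_range_add_finrank_ker (extMulVec K n (p + 1) v).mulVecLin
  rw [Module.finrank_fintype_fun_eq_card, card_extIdx] at hrn
  unfold Matrix.rank
  omega

/-- `|{S ∈ ExtIdx n p : i₀ ∉ S}| = C(n − 1, p)`. [cite: DerksenMakam2018, Lemma 4.1 (proof), p. 9] locator: paper:arxiv-1606.06701 p0009.txt:L20 -/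
theorem card_extIdx_not_mem {n p : ℕ} (i₀ : Fin n) :
    Fintype.card {S : ExtIdx n p // i₀ ∉ S.1} = (n - 1).choose p := by
  classical
  let t : Finset (Finset (Fin n)) := Finset.powersetCard p (Finset.univ.erase i₀)
  let e : {S : ExtIdx n p // i₀ ∉ S.1} ≃ t :=
    { toFun := fun S => ⟨S.1.1, by
        refine Finset.mem_powersetCard.2 ⟨fun x hx => ?_, S.1.2⟩
        exact Finset.mem_erase.2 ⟨fun h => S.2 (h ▸ hx), Finset.mem_univ _⟩⟩
      invFun := fun s => ⟨⟨s.1, (Finset.mem_powersetCard.1 s.2).2⟩, fun h =>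
        by simpa using (Finset.mem_powersetCard.1 s.2).1 h⟩
      left_inv := fun S => rfl
      right_inv := fun s => rfl }
  rw [Fintype.card_congr e, Fintype.card_coe, Finset.card_powersetCard, Finset.card_erase_of_mem
    (Finset.mem_univ _), Finset.card_univ, Fintype.card_fin]

/-- **The diagonal minor**: on rows `S ∪ {i₀}` and columns `S` (`i₀ ∉ S`) the matrix `L_v^{(p)}` is
diagonal with entries `± v_{i₀}` (the identity block of [DM16, Lemma 4.1 / Cor 4.4] for `v = e_n`).
[cite: DerksenMakam2018, Lemma 4.1, p. 9] locator: paper:arxiv-1606.06701 p0009.txt:L9 -/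
theorem extMulVec_submatrix_eq_diagonal {n p : ℕ} (v : Fin n → K) (i₀ : Fin n) :
    (extMulVec K n p v).submatrix
        (fun S : {S : ExtIdx n p // i₀ ∉ S.1} =>
          (⟨insert i₀ S.1.1, by rw [Finset.card_insert_of_notMem S.2, S.1.2]⟩ : ExtIdx n (p + 1)))
        (fun S => S.1) =
      Matrix.diagonal fun S => v i₀ * wedgeSign K i₀ S.1.1 := by
  classical
  ext S S'
  rw [Matrix.submatrix_apply, extMulVec_apply, Matrix.diagonal_apply]
  by_cases hSS : S = S'
  · subst hSS
    rw [if_pos rfl, Finset.sum_eq_single i₀]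
    · rw [if_pos rfl]
    · intro i _ hi
      rw [if_neg]
      intro h
      have : i₀ ∈ insert i S.1.1 := h ▸ Finset.mem_insert_self _ _
      rcases Finset.mem_insert.1 this with h' | h'
      · exact hi h'.symm
      · exact S.2 h'
    · exact fun h => absurd (Finset.mem_univ _) h
  · rw [if_neg hSS]
    refine Finset.sum_eq_zero fun i _ => if_neg fun h => ?_
    have hi₀ : i₀ ∈ insert i S'.1.1 := h ▸ Finset.mem_insert_self _ _
    rcases Finset.mem_insert.1 hi₀ with h' | h'
    · subst h'
      apply hSS
      have : S.1.1 = S'.1.1 := by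
        rw [← Finset.erase_insert S.2, ← Finset.erase_insert S'.2]
        exact congrArg (fun s => Finset.erase s i₀) h
      exact Subtype.ext (Subtype.ext this)
    · exact S'.2 h'

/-- **Lower bound**: if `v_{i₀} ≠ 0` then `rk L_v^{(p)} ≥ C(n−1, p)` (an invertible diagonal minor).
[cite: DerksenMakam2018, Cor 4.4, p. 9] locator: paper:arxiv-1606.06701 p0009.txt:L50 -/
theorem choose_le_rank_extMulVec {n p : ℕ} {v : Fin n → K} {i₀ : Fin n} (hv : v i₀ ≠ 0) :
    (n - 1).choose p ≤ (extMulVec K n p v).rank := by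
  classical
  have h := Matrix.rank_submatrix_le (extMulVec K n p v)
    (fun S : {S : ExtIdx n p // i₀ ∉ S.1} =>
      (⟨insert i₀ S.1.1, by rw [Finset.card_insert_of_notMem S.2, S.1.2]⟩ : ExtIdx n (p + 1)))
    (fun S : {S : ExtIdx n p // i₀ ∉ S.1} => S.1)
  have hne : ∀ S : {S : ExtIdx n p // i₀ ∉ S.1}, v i₀ * wedgeSign K i₀ S.1.1 ≠ 0 := fun S h0 => by
    rcases mul_eq_zero.1 h0 with h0 | h0
    · exact hv h0
    · simpa [h0] using wedgeSign_mul_self (R := K) i₀ S.1.1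
  have hcard : Fintype.card {S : {S : ExtIdx n p // i₀ ∉ S.1} // v i₀ * wedgeSign K i₀ S.1.1 ≠ 0} =
      (n - 1).choose p := by
    rw [Fintype.card_of_subtype Finset.univ fun S => ⟨fun _ => hne S, fun _ => Finset.mem_univ _⟩,
      Finset.card_univ, card_extIdx_not_mem]
  rw [extMulVec_submatrix_eq_diagonal, Matrix.rank_diagonal, hcard] at h
  exact h

/-- **[DM16, Corollary 4.4]: for any non-zero `v ∈ K^n`, `rk(L_v) = C(n−1, p)`** — proved here over
every field by the diagonal minor (lower bound) and the complex `L_v ∘ L_v = 0` with rank–nullity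
(upper bound), instead of the paper's change of basis to `v = e_n`.
[cite: DerksenMakam2018, Cor 4.4, p. 9] locator: paper:arxiv-1606.06701 p0009.txt:L50 -/
theorem DerksenMakam2018_cor_4_4 {n p : ℕ} {v : Fin n → K} (hv : v ≠ 0) :
    (extMulVec K n p v).rank = (n - 1).choose p := by
  obtain ⟨i₀, hi₀⟩ := Function.ne_iff.1 hv
  refine le_antisymm ?_ (choose_le_rank_extMulVec hi₀)
  obtain ⟨m, rfl⟩ : ∃ m, n = m + 1 := ⟨n - 1, by have := i₀.2; omega⟩
  cases p with
  | zero =>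
    refine (Matrix.rank_le_card_width _).trans ?_
    rw [card_extIdx]
    simp
  | succ q =>
    have h1 := rank_extMulVec_succ_add_rank_le (p := q) v
    have h2 := choose_le_rank_extMulVec (p := q) hi₀
    rw [Nat.choose_succ_succ'] at h1
    simp only [Nat.add_sub_cancel] at h2 ⊢
    omega

variable (K)

/-- **[DM16, Thm 1.15 / §4] the matrix space `𝒳(p,n) = span{L_{e₁}, …, L_{e_n}}`** = the image of
`L : K^n → Hom(Λ^p K^n, Λ^{p+1} K^n)`. [cite: DerksenMakam2018, Thm 1.15, p. 4] locator: paper:arxiv-1606.06701 p0004.txt:L42 -/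
def dmSpace (n p : ℕ) : Submodule K (Matrix (ExtIdx n (p + 1)) (ExtIdx n p) K) :=
  Submodule.span K (Set.range (extMulMatrix K n p))

/-- **[DM16, §4] the linear matrix `A(p,n) = t₁ L_{e₁} + ⋯ + t_n L_{e_n}`.**
[cite: DerksenMakam2018, §4, p. 9] locator: paper:arxiv-1606.06701 p0009.txt:L5 -/
noncomputable def dmLinearMatrix (n p : ℕ) :
    Matrix (ExtIdx n (p + 1)) (ExtIdx n p) (MvPolynomial (Fin n) K) :=
  genericCombination (extMulMatrix K n p)

variable {K}

/-- Members of `𝒳(p,n)` are exactly the `L_v`. [cite: DerksenMakam2018, Thm 1.15, p. 4] locator: paper:arxiv-1606.06701 p0004.txt:L40 -/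
theorem mem_dmSpace_iff {n p : ℕ} {M : Matrix (ExtIdx n (p + 1)) (ExtIdx n p) K} :
    M ∈ dmSpace K n p ↔ ∃ v : Fin n → K, extMulVec K n p v = M :=
  Submodule.mem_span_range_iff_exists_fun K

/-- **[DM16, Cor 4.5], matrix-space half: `rk 𝒳(p,n) = C(n−1,p)`** (`n ≥ 1`; every field).
[cite: DerksenMakam2018, Cor 4.5, p. 9] locator: paper:arxiv-1606.06701 p0009.txt:L57 -/
theorem matrixSetRank_dmSpace {n p : ℕ} (hn : 0 < n) :
    matrixSetRank (dmSpace K n p : Set (Matrix (ExtIdx n (p + 1)) (ExtIdx n p) K)) =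
      (n - 1).choose p := by
  refine le_antisymm (matrixSetRank_le fun M hM => ?_) ?_
  · obtain ⟨v, rfl⟩ := mem_dmSpace_iff.1 hM
    rcases eq_or_ne v 0 with rfl | hv
    · have : extMulVec K n p 0 = 0 := by simp [extMulVec]
      rw [this, Matrix.rank_zero]
      exact Nat.zero_le _
    · exact (DerksenMakam2018_cor_4_4 hv).le
  · have hv : (fun _ : Fin n => (1 : K)) ≠ 0 :=
      Function.ne_iff.2 ⟨⟨0, hn⟩, one_ne_zero⟩
    rw [← DerksenMakam2018_cor_4_4 (p := p) hv]
    exact rank_le_matrixSetRank (mem_dmSpace_iff.2 ⟨_, rfl⟩)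

/-- `A(p,n)` under a ring map `φ` out of `K[t]` is `L_{φ(t)}`. [cite: DerksenMakam2018, §4, p. 9] locator: paper:arxiv-1606.06701 p0009.txt:L5 -/
theorem dmLinearMatrix_map {n p : ℕ} {L : Type*} [CommRing L] (φ : MvPolynomial (Fin n) K →+* L) :
    (dmLinearMatrix K n p).map φ = extMulVec L n p fun i => φ (MvPolynomial.X i) := by
  ext T S
  rw [Matrix.map_apply, dmLinearMatrix, genericCombination_apply, map_sum, extMulVec_apply]
  refine Finset.sum_congr rfl fun i _ => ?_
  rw [map_mul, extMulMatrix, Matrix.of_apply]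
  split_ifs
  · simp [wedgeSign]
  · simp

/-- **[DM16, Corollary 4.5]: `crk A(p,n) = rk 𝒳(p,n) = C(n−1, p)`** — the commutative-rank half, as
the rank over `K(t)` (tree `symbolicRank`; `n ≥ 1`, every field).
[cite: DerksenMakam2018, Cor 4.5, p. 9] locator: paper:arxiv-1606.06701 p0009.txt:L57 -/
theorem DerksenMakam2018_cor_4_5 {n p : ℕ} (hn : 0 < n) :
    symbolicRank (dmLinearMatrix K n p) = (n - 1).choose p := by
  unfold symbolicRank
  rw [dmLinearMatrix_map]
  refine DerksenMakam2018_cor_4_4 (Function.ne_iff.2 ⟨⟨0, hn⟩, ?_⟩)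
  rw [Pi.zero_apply]
  exact fun h => MvPolynomial.X_ne_zero _
    ((IsFractionRing.injective (MvPolynomial (Fin n) K) (FractionRing (MvPolynomial (Fin n) K)))
      (h.trans (map_zero _).symm))

variable (K)

/-- The Toeplitz shift `S_r` of [DM16, Prop 4.6] (`S_r(j,k) = 1` iff `j = k + r`), here for
`r = i − p` with `i ∈ {0, …, 2p}` the `0`-based index of `e_{i+1}`: entry `(j,k) = 1` iff `j + p = k + i`.
[cite: DerksenMakam2018, Prop 4.6, p. 9] locator: paper:arxiv-1606.06701 p0009.txt:L66 -/
def toeplitzShift (p : ℕ) (i : Fin (2 * p + 1)) : Matrix (Fin (p + 1)) (Fin (p + 1)) K :=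
  Matrix.of fun j k => if (j : ℕ) + p = k + i then 1 else 0

/-- **Landsberg's blow-up matrix `L_{e₁} ⊗ S_{−p} + L_{e₂} ⊗ S_{−p+1} + ⋯ + L_{e_{2p+1}} ⊗ S_p`** of
[DM16, Prop 4.6], a member of the `(p+1, p+1)` blow-up of `𝒳(p, 2p+1)` of size
`C(2p+1,p)(p+1) × C(2p+1,p)(p+1)`. [cite: DerksenMakam2018, Prop 4.6, p. 9] locator: paper:arxiv-1606.06701 p0009.txt:L62 -/
def landsbergMatrix (p : ℕ) :
    Matrix (ExtIdx (2 * p + 1) (p + 1) × Fin (p + 1)) (ExtIdx (2 * p + 1) p × Fin (p + 1)) K :=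
  ∑ i, Matrix.kroneckerMap (· * ·) (extMulMatrix K (2 * p + 1) p i) (toeplitzShift K p i)

/-- **[DM16, Proposition 4.6] ([Landsberg2015]) — NAMED FACT, not proved here.** "Let `e₁, …, e_{2p+1}`
be a basis for `ℂ^{2p+1}`. For `−p ≤ r ≤ p` let `S_r` be the `(p+1) × (p+1)` matrix with
`S_r(j,k) = 1` if `j = k + r` and `0` otherwise. Then `L_{e₁} ⊗ S_{−p} + L_{e₂} ⊗ S_{−p+1} + ⋯ +
L_{e_{2p+1}} ⊗ S_p` is invertible." Typed over any field of characteristic `0` (the matrix has entries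
in `{0, ±1}`, so invertibility over `ℂ` is invertibility over `ℚ`); "invertible" for this matrix, square
in cardinality (`C(2p+1,p+1) = C(2p+1,p)`), is typed as FULL RANK `= #columns`. This is the external
input ([Landsberg2015], Koszul-flattening equations) of [DM16, §4]; R-class.
[cite: DerksenMakam2018, Prop 4.6, p. 9] locator: paper:arxiv-1606.06701 p0009.txt:L62 -/
def DerksenMakam2018_prop_4_6 [CharZero K] (p : ℕ) : Prop :=
  (landsbergMatrix K p).rank = Fintype.card (ExtIdx (2 * p + 1) p × Fin (p + 1))

/-- **[DM16, Theorem 1.15] — NAMED FACT as printed** (proved below from Prop 4.6: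
`DerksenMakam2018_thm_1_15_of_prop_4_6`): "Let `𝒳(p,2p+1)` denote the image of
`L : K^{2p+1} → Hom(Λ^p K^{2p+1}, Λ^{p+1} K^{2p+1})`. We have
`ncrk(𝒳(p,2p+1)) / rk(𝒳(p,2p+1)) = (2p+1)/(p+1)`" — typed cross-multiplied in `ℕ`, with `ncrk` the
shrunk-subspace non-commutative rank `ncRank` and `rk` the maximal rank `matrixSetRank`; `K` of
characteristic `0` ([DM16, §4]: "We assume char `K = 0` for this section"; the paper's standing
assumption is an infinite field). Equivalent to `ncrk 𝒳(p,2p+1) = C(2p+1,p)` (full), see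
`DerksenMakam2018_thm_1_15_iff`. [cite: DerksenMakam2018, Thm 1.15, p. 4] locator: paper:arxiv-1606.06701 p0004.txt:L42 -/
def DerksenMakam2018_thm_1_15 [CharZero K] (p : ℕ) : Prop :=
  (p + 1) * ncRank (dmSpace K (2 * p + 1) p : Set (Matrix (ExtIdx (2 * p + 1) (p + 1))
      (ExtIdx (2 * p + 1) p) K)) =
    (2 * p + 1) * matrixSetRank (dmSpace K (2 * p + 1) p : Set (Matrix (ExtIdx (2 * p + 1) (p + 1))
      (ExtIdx (2 * p + 1) p) K))

variable {K}

/-- Landsberg's matrix lies in the `(p+1,p+1)` blow-up of `𝒳(p,2p+1)`.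
[cite: DerksenMakam2018, Cor 4.7 (proof), p. 9] locator: paper:arxiv-1606.06701 p0009.txt:L75 -/
theorem landsbergMatrix_mem_blowUp (p : ℕ) :
    landsbergMatrix K p ∈ blowUp (Set.range (extMulMatrix K (2 * p + 1) p)) (Fin (p + 1)) (Fin (p + 1)) :=
  Submodule.sum_mem _ fun i _ => Submodule.subset_span ⟨_, ⟨i, rfl⟩, _, rfl⟩

/-- `ncrk(𝒳(p,n)) = ncrk{L_{e_i}}` (span invariance). [cite: DerksenMakam2018, Def 1.9, p. 3] locator: paper:arxiv-1606.06701 p0003.txt:L88 -/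
theorem ncRank_dmSpace (n p : ℕ) :
    ncRank (dmSpace K n p : Set (Matrix (ExtIdx n (p + 1)) (ExtIdx n p) K)) =
      ncRank (Set.range (extMulMatrix K n p)) :=
  ncRank_span _

/-- **[DM16, Corollary 4.7] from Prop 4.6: the linear matrix `A(p,2p+1)` has full non-commutative
rank `C(2p+1,p)`** (full-rank member of the `(p+1)`-blow-up ⇒ no shrunk subspace).
[cite: DerksenMakam2018, Cor 4.7, p. 9] locator: paper:arxiv-1606.06701 p0009.txt:L75 -/
theorem DerksenMakam2018_cor_4_7_of_prop_4_6 [CharZero K] {p : ℕ} (h : DerksenMakam2018_prop_4_6 K p) :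
    ncRank (dmSpace K (2 * p + 1) p : Set (Matrix (ExtIdx (2 * p + 1) (p + 1))
      (ExtIdx (2 * p + 1) p) K)) = (2 * p + 1).choose p := by
  rw [ncRank_dmSpace, ← card_extIdx (2 * p + 1) p]
  refine ncRank_eq_card_of_mem_blowUp (landsbergMatrix_mem_blowUp p) (le_of_eq ?_)
  rw [DerksenMakam2018_prop_4_6] at h
  rw [h, Fintype.card_prod, Fintype.card_fin, mul_comm]

/-- `(p+1) · C(2p+1, p) = (2p+1) · C(2p, p)`. [cite: DerksenMakam2018, §4, p. 9] locator: paper:arxiv-1606.06701 p0009.txt:L59 -/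
theorem succ_mul_choose_two_mul_add_one (p : ℕ) :
    (p + 1) * (2 * p + 1).choose p = (2 * p + 1) * (2 * p).choose p := by
  rw [← Nat.choose_symm_half, mul_comm, ← Nat.add_one_mul_choose_eq]

/-- **[DM16, Thm 1.15] ⟺ "`ncrk 𝒳(p,2p+1) = C(2p+1,p)` is full"**, given the PROVED commutative
half `rk 𝒳(p,2p+1) = C(2p,p)` ([DM16, Cor 4.5]) and the identity `(p+1)C(2p+1,p) = (2p+1)C(2p,p)`.
[cite: DerksenMakam2018, Thm 1.15, p. 4] locator: paper:arxiv-1606.06701 p0009.txt:L59 -/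
theorem DerksenMakam2018_thm_1_15_iff [CharZero K] (p : ℕ) :
    DerksenMakam2018_thm_1_15 K p ↔
      ncRank (dmSpace K (2 * p + 1) p : Set (Matrix (ExtIdx (2 * p + 1) (p + 1))
        (ExtIdx (2 * p + 1) p) K)) = (2 * p + 1).choose p := by
  rw [DerksenMakam2018_thm_1_15, matrixSetRank_dmSpace (by omega), Nat.add_sub_cancel,
    ← succ_mul_choose_two_mul_add_one]
  exact ⟨fun h => Nat.eq_of_mul_eq_mul_left (Nat.succ_pos p) h, fun h => by rw [h]⟩

/-- **[DM16, Theorem 1.15] from [DM16, Prop 4.6]** (the printed proof: Cor 4.5 + Cor 4.7).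
[cite: DerksenMakam2018, Thm 1.15, p. 9] locator: paper:arxiv-1606.06701 p0009.txt:L81 -/
theorem DerksenMakam2018_thm_1_15_of_prop_4_6 [CharZero K] {p : ℕ} (h : DerksenMakam2018_prop_4_6 K p) :
    DerksenMakam2018_thm_1_15 K p :=
  (DerksenMakam2018_thm_1_15_iff p).2 (DerksenMakam2018_cor_4_7_of_prop_4_6 h)

/-- **`hrk(A(p,n))`-form**: the homogeneous rank ([EGOW18, Def 3.1]) is defined for matrices with
one index type; `A(p,2p+1)` becomes square after relabelling `Λ^{p+1}` and `Λ^p` by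
`Fin C(2p+1,p)`. This is the relabelled coefficient family `(L_{e_i})_i`.
[cite: DerksenMakam2018, §4, p. 9] locator: paper:arxiv-1606.06701 p0009.txt:L59 -/
noncomputable def dmSquareFamily (K : Type*) [Field K] (p : ℕ) (i : Fin (2 * p + 1)) :
    Matrix (Fin ((2 * p + 1).choose p)) (Fin ((2 * p + 1).choose p)) K :=
  Matrix.reindex
    (Fintype.equivFinOfCardEq (by rw [card_extIdx, ← Nat.choose_symm_half]))
    (Fintype.equivFinOfCardEq (card_extIdx _ _))
    (extMulMatrix K (2 * p + 1) p i)

end ExteriorMultiplication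

/-! ## 4. [EGOW18, §6]: linear matrices with `hrk ≥ (2 − ε) · rk` and Conjecture 6.1 at `d = 1` -/

section EGOW

variable (F : Type*) [Field F]

/-- **[EGOW18, §6, bullet 4 (p. 17, before Conj. 6.1)] — NAMED STATEMENT as printed:** "Derksen and
Makam prove in [DM16] that there exists a linear matrix `M(x)` of rank `r` whose homogeneous rank is
lower bounded by `(2 − ε) · r`." Reading: for every real `ε > 0` there are `n`, `m` and a square
matrix `M(x)` of linear forms (homogeneous degree-`1` entries) in `n` variables with
`rk_{F(x)}(M) = r` and `hrk(M) ≥ (2 − ε) r` (tree `symbolicRank`, `homogRank` = [EGOW18, §2.2,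
Def 3.1]); `0 < r` is added because the zero matrix satisfies the printed sentence vacuously. The
source's field is of characteristic zero. A published THEOREM ([DM16, Thm 1.15]), PROVED below
from [DM16, Thm 1.15] for all `p` (`EGOW2018_sec6_derksenMakam_of_thm_1_15`), i.e. reduced to the
single external input [DM16, Prop 4.6] = [Landsberg2015]; it is the `d = 1` companion of the Summits
leaf `EGOW2018_conj61Over` (not imported here). [cite: EfremenkoGargOliveiraWigderson2018, §6, p. 17] locator: paper:arxiv-1710.09502 p0017.txt:L20 -/
def EGOW2018_sec6_derksenMakam : Prop :=
  ∀ ε : ℝ, 0 < ε →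
    ∃ (n m r : ℕ) (M : Matrix (Fin m) (Fin m) (MvPolynomial (Fin n) F)),
      (∀ i j, (M i j).IsHomogeneous 1) ∧ symbolicRank M = r ∧ 0 < r ∧
        (2 - ε) * r ≤ (homogRank M : ℝ)

variable {F}

/-- The relabelled linear matrix `A(p,2p+1)` is `∑ tᵢ Bᵢ` for the relabelled family.
[cite: DerksenMakam2018, §4, p. 9] locator: paper:arxiv-1606.06701 p0009.txt:L5 -/
theorem genericCombination_dmSquareFamily (p : ℕ) :
    genericCombination (dmSquareFamily F p) =
      Matrix.reindex (Fintype.equivFinOfCardEq (by rw [card_extIdx, ← Nat.choose_symm_half]))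
        (Fintype.equivFinOfCardEq (card_extIdx _ _)) (dmLinearMatrix F (2 * p + 1) p) := by
  refine Matrix.ext fun i j => ?_
  rw [genericCombination_apply, Matrix.reindex_apply, Matrix.submatrix_apply, dmLinearMatrix,
    genericCombination_apply]
  rfl

/-- `rk_{F(t)}` of the relabelled `A(p,2p+1)` is `C(2p,p)`. [cite: DerksenMakam2018, Cor 4.5, p. 9] locator: paper:arxiv-1606.06701 p0009.txt:L57 -/
theorem symbolicRank_genericCombination_dmSquareFamily (p : ℕ) :
    symbolicRank (genericCombination (dmSquareFamily F p)) = (2 * p).choose p := by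
  rw [genericCombination_dmSquareFamily, symbolicRank, Matrix.reindex_apply, ← Matrix.submatrix_map,
    Matrix.rank_submatrix, ← symbolicRank, DerksenMakam2018_cor_4_5 (by omega)]
  simp

/-- `ncrk` of the relabelled family = `ncrk{L_{e_i}} = ncrk 𝒳(p,2p+1)`.
[cite: DerksenMakam2018, Thm 1.15, p. 4] locator: paper:arxiv-1606.06701 p0004.txt:L42 -/
theorem ncRank_range_dmSquareFamily (p : ℕ) :
    ncRank (Set.range (dmSquareFamily F p)) =
      ncRank (dmSpace F (2 * p + 1) p : Set (Matrix (ExtIdx (2 * p + 1) (p + 1))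
        (ExtIdx (2 * p + 1) p) F)) := by
  rw [ncRank_dmSpace]
  have : Set.range (dmSquareFamily F p) =
      (Matrix.reindex (Fintype.equivFinOfCardEq (by rw [card_extIdx, ← Nat.choose_symm_half]))
        (Fintype.equivFinOfCardEq (card_extIdx _ _))) '' Set.range (extMulMatrix F (2 * p + 1) p) := by
    rw [← Set.range_comp]
    rfl
  rw [this, ncRank_image_reindex]

/-- **[DM16, Thm 1.15] in the language of [EGOW18]: the linear matrix `A(p,2p+1)` (relabelled square)
has `rk_{F(t)} = C(2p,p)` and `hrk = C(2p+1,p) = (2 − 1/(p+1)) · rk`.**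
[cite: EfremenkoGargOliveiraWigderson2018, §6, p. 17] locator: paper:arxiv-1710.09502 p0017.txt:L20 -/
theorem homogRank_genericCombination_dmSquareFamily [CharZero F] {p : ℕ}
    (h : DerksenMakam2018_thm_1_15 F p) :
    homogRank (genericCombination (dmSquareFamily F p)) = (2 * p + 1).choose p := by
  rw [homogRank_genericCombination_eq_ncRank, ncRank_range_dmSquareFamily]
  exact (DerksenMakam2018_thm_1_15_iff p).1 h

/-- The inequality `(2 − ε) C(2p,p) < C(2p+1,p)` once `1/(p+1) < ε`.
[cite: EfremenkoGargOliveiraWigderson2018, §6, p. 17] locator: paper:arxiv-1710.09502 p0017.txt:L20 -/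
theorem two_sub_eps_mul_choose_lt {ε : ℝ} {p : ℕ} (hε : 1 / ((p : ℝ) + 1) < ε) :
    (2 - ε) * ((2 * p).choose p : ℕ) < (((2 * p + 1).choose p : ℕ) : ℝ) := by
  have hid : ((p : ℝ) + 1) * ((2 * p + 1).choose p : ℕ) = (2 * (p : ℝ) + 1) * ((2 * p).choose p : ℕ) := by
    exact_mod_cast succ_mul_choose_two_mul_add_one p
  have hpos : (0 : ℝ) < ((2 * p).choose p : ℕ) := by exact_mod_cast Nat.choose_pos (by omega)
  have hp1 : (0 : ℝ) < (p : ℝ) + 1 := by positivity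
  have hε' : 1 < ε * ((p : ℝ) + 1) := by rwa [div_lt_iff₀ hp1] at hε
  have key : (((2 * p + 1).choose p : ℕ) : ℝ) =
      (2 - 1 / ((p : ℝ) + 1)) * ((2 * p).choose p : ℕ) := by
    field_simp
    linarith [hid]
  rw [key]
  have : 2 - ε < 2 - 1 / ((p : ℝ) + 1) := by linarith
  exact mul_lt_mul_of_pos_right this hpos

/-- **[EGOW18, §6 bullet 4] from [DM16, Thm 1.15] (all `p`).** For `ε > 0` take `p` with
`1/(p+1) < ε` and `M = A(p, 2p+1)`: `rk = C(2p,p) > 0`, `hrk = C(2p+1,p) = (2 − 1/(p+1)) rk ≥ (2 − ε) rk`.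
[cite: EfremenkoGargOliveiraWigderson2018, §6, p. 17] locator: paper:arxiv-1710.09502 p0017.txt:L20 -/
theorem EGOW2018_sec6_derksenMakam_of_thm_1_15 [CharZero F] (h : ∀ p, DerksenMakam2018_thm_1_15 F p) :
    EGOW2018_sec6_derksenMakam F := by
  intro ε hε
  obtain ⟨p, hp⟩ := exists_nat_gt (1 / ε)
  have hpε : 1 / ((p : ℝ) + 1) < ε := by
    rw [div_lt_iff₀ (by positivity)]
    rw [div_lt_iff₀ hε] at hp
    nlinarith
  refine ⟨2 * p + 1, (2 * p + 1).choose p, (2 * p).choose p, genericCombination (dmSquareFamily F p),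
    isHomogeneous_genericCombination _, symbolicRank_genericCombination_dmSquareFamily p,
    Nat.choose_pos (by omega), ?_⟩
  rw [homogRank_genericCombination_dmSquareFamily (h p)]
  exact (two_sub_eps_mul_choose_lt hpε).le

/-- **[EGOW18, Conjecture 6.1] holds at `d = 1`** (from [DM16, Thm 1.15] for all `p`): for every real
`ε > 0` there is a square matrix of linear forms with `hrk(M) > (1 + 1 − ε) · rk_{F(x)}(M)` — the
`d = 1` instance, clause for clause, of the Summits conjecture leaf `EGOW2018_conj61Over F`
(`∀ d ε, 0 < ε → ∃ n m r M, (∀ i j, IsHomogeneous (M i j) d) ∧ symbolicRank M = r ∧ (d+1−ε) r < hrk M`),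
which is not imported here; a prover closes that instance by `fun ε hε => this ε hε`.
[cite: EfremenkoGargOliveiraWigderson2018, Conj 6.1, p. 17] locator: paper:arxiv-1710.09502 p0017.txt:L27 -/
theorem EGOW2018_conj61_degOne_of_thm_1_15 [CharZero F] (h : ∀ p, DerksenMakam2018_thm_1_15 F p)
    (ε : ℝ) (hε : 0 < ε) :
    ∃ (n m r : ℕ) (M : Matrix (Fin m) (Fin m) (MvPolynomial (Fin n) F)),
      (∀ i j, (M i j).IsHomogeneous 1) ∧ symbolicRank M = r ∧
        (((1 : ℕ) : ℝ) + 1 - ε) * r < (homogRank M : ℝ) := by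
  obtain ⟨p, hp⟩ := exists_nat_gt (1 / ε)
  have hpε : 1 / ((p : ℝ) + 1) < ε := by
    rw [div_lt_iff₀ (by positivity)]
    rw [div_lt_iff₀ hε] at hp
    nlinarith
  refine ⟨2 * p + 1, (2 * p + 1).choose p, (2 * p).choose p, genericCombination (dmSquareFamily F p),
    isHomogeneous_genericCombination _, symbolicRank_genericCombination_dmSquareFamily p, ?_⟩
  rw [homogRank_genericCombination_dmSquareFamily (h p)]
  have : ((1 : ℕ) : ℝ) + 1 - ε = 2 - ε := by norm_num
  rw [this]
  exact two_sub_eps_mul_choose_lt hpε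

/-- The same two statements from the single external input [DM16, Prop 4.6] = [Landsberg2015].
[cite: EfremenkoGargOliveiraWigderson2018, §6, p. 17] locator: paper:arxiv-1710.09502 p0017.txt:L20 -/
theorem EGOW2018_sec6_derksenMakam_of_prop_4_6 [CharZero F] (h : ∀ p, DerksenMakam2018_prop_4_6 F p) :
    EGOW2018_sec6_derksenMakam F :=
  EGOW2018_sec6_derksenMakam_of_thm_1_15 fun p => DerksenMakam2018_thm_1_15_of_prop_4_6 (h p)

end EGOW

/-! ## 5. Unconditional instance `p = 1` ([DM16, Example 1.1 / Cor 1.16(1), i = 1]): `crk = n − 1 < n = ncrk` -/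

section DegreeOne

variable {K : Type*} [Field K]

/-- Every basis vector `e_T` of `Λ^{p+1}` is hit: `e_T = ± L_{e_i} e_{T ∖ i}` for `i ∈ T`; so
`𝒳(p,n)(Λ^p) = Λ^{p+1}` (the space is "onto"). [cite: DerksenMakam2018, Cor 1.16, p. 4] locator: paper:arxiv-1606.06701 p0004.txt:L51 -/
theorem imageSubspace_range_extMulMatrix_top (n p : ℕ) :
    imageSubspace (Set.range (extMulMatrix K n p)) ⊤ = ⊤ := by
  classical
  refine eq_top_iff.2 fun w _ => ?_
  rw [← Finset.univ_sum_single w]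
  refine Submodule.sum_mem _ fun T _ => ?_
  obtain ⟨i, hi⟩ : T.1.Nonempty := Finset.card_pos.1 (by rw [T.2]; exact Nat.succ_pos p)
  let S : ExtIdx n p := ⟨T.1.erase i, by rw [Finset.card_erase_of_mem hi, T.2, Nat.add_sub_cancel]⟩
  have hcol : (extMulMatrix K n p i).mulVec (Pi.single S 1) = wedgeSign K i S.1 • Pi.single T (1 : K) := by
    rw [Matrix.mulVec_single_one]
    funext T'
    change extMulMatrix K n p i T' S = _
    rw [extMulMatrix, Matrix.of_apply, Pi.smul_apply, smul_eq_mul]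
    have hS : insert i S.1 = T.1 := Finset.insert_erase hi
    rw [hS]
    by_cases h : T' = T
    · subst h; simp
    · rw [if_neg (fun h' => h (Subtype.ext h')), Pi.single_eq_of_ne h, mul_zero]
  have hmem : wedgeSign K i S.1 • (extMulMatrix K n p i).mulVec (Pi.single S 1) ∈
      imageSubspace (Set.range (extMulMatrix K n p)) ⊤ :=
    Submodule.smul_mem _ _ (map_mulVecLin_le_imageSubspace (𝓑 := Set.range (extMulMatrix K n p))
      (B := extMulMatrix K n p i) ⟨i, rfl⟩ ⊤ ⟨Pi.single S 1, trivial, rfl⟩)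
  rw [hcol, smul_smul, wedgeSign_mul_self, one_smul] at hmem
  have : Pi.single T (w T) = w T • (Pi.single T (1 : K) : ExtIdx n (p + 1) → K) := by
    rw [← Pi.single_smul', smul_eq_mul, mul_one]
  rw [this]
  exact Submodule.smul_mem _ _ hmem

/-- `p = 1`: the columns `L_{eᵢ} v` of the matrix of `u ↦ u ∧ v` lie in `𝒳(1,n)(V)` whenever `v ∈ V`.
[cite: DerksenMakam2018, Example 1.1, p. 2] locator: paper:arxiv-1606.06701 p0003.txt:L9 -/
theorem wedgeWith_mulVec_mem {n : ℕ} {V : Submodule K (ExtIdx n 1 → K)} {v : ExtIdx n 1 → K}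
    (hv : v ∈ V) (u : Fin n → K) :
    (Matrix.of fun (T : ExtIdx n 2) (i : Fin n) => (extMulMatrix K n 1 i).mulVec v T).mulVec u ∈
      imageSubspace (Set.range (extMulMatrix K n 1)) V := by
  have : (Matrix.of fun (T : ExtIdx n 2) (i : Fin n) => (extMulMatrix K n 1 i).mulVec v T).mulVec u =
      ∑ i, u i • (extMulMatrix K n 1 i).mulVec v := by
    funext T
    simp only [Matrix.mulVec, dotProduct, Matrix.of_apply, Finset.sum_apply,
      Pi.smul_apply, smul_eq_mul]
    exact Finset.sum_congr rfl fun i _ => mul_comm _ _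
  rw [this]
  exact Submodule.sum_mem _ fun i _ =>
    Submodule.smul_mem _ _ (map_mulVecLin_le_imageSubspace (𝓑 := Set.range (extMulMatrix K n 1))
      (B := extMulMatrix K n 1 i) ⟨i, rfl⟩ V ⟨v, hv, rfl⟩)

/-- `p = 1`: on rows `{i, s₀}` and columns `i` (`i ≠ s₀`) the matrix `(u ↦ L_u v)` is diagonal with
entries `± v_{s₀}` (the anti-commutativity `u ∧ v = −v ∧ u` in coordinates).
[cite: DerksenMakam2018, Example 1.1, p. 2] locator: paper:arxiv-1606.06701 p0003.txt:L9 -/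
theorem wedgeWith_submatrix_eq_diagonal {n : ℕ} (v : ExtIdx n 1 → K) (s₀ : Fin n) :
    (Matrix.of fun (T : ExtIdx n 2) (i : Fin n) => (extMulMatrix K n 1 i).mulVec v T).submatrix
        (fun i : {i : Fin n // i ≠ s₀} =>
          (⟨{i.1, s₀}, Finset.card_pair i.2⟩ : ExtIdx n 2))
        (fun i => i.1) =
      Matrix.diagonal fun i => wedgeSign K i.1 {s₀} * v ⟨{s₀}, Finset.card_singleton s₀⟩ := by
  classical
  ext i i'
  rw [Matrix.submatrix_apply, Matrix.of_apply, Matrix.diagonal_apply]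
  simp only [Matrix.mulVec, dotProduct, extMulMatrix, Matrix.of_apply, ite_mul, zero_mul]
  by_cases h : i = i'
  · subst h
    rw [if_pos rfl, Finset.sum_eq_single ⟨{s₀}, Finset.card_singleton s₀⟩]
    · rw [if_pos]; rfl
    · rintro S - hS
      rw [if_neg]
      intro hS'
      apply hS
      apply Subtype.ext
      obtain ⟨a, ha⟩ := Finset.card_eq_one.1 S.2
      rw [ha] at hS' ⊢
      have : a ∈ ({i.1, s₀} : Finset (Fin n)) := hS' ▸ Finset.mem_insert_of_mem (Finset.mem_singleton_self a)
      rcases Finset.mem_insert.1 this with h1 | h1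
      · exfalso
        have hcard := congrArg Finset.card hS'
        rw [h1, Finset.card_pair i.2, Finset.insert_eq_of_mem (Finset.mem_singleton_self _),
          Finset.card_singleton] at hcard
        omega
      · rw [Finset.mem_singleton.1 h1]
    · exact fun h => absurd (Finset.mem_univ _) h
  · rw [if_neg h]
    refine Finset.sum_eq_zero fun S _ => ?_
    rw [if_neg]
    intro hS'
    have : i'.1 ∈ ({i.1, s₀} : Finset (Fin n)) := hS' ▸ Finset.mem_insert_self _ _
    rcases Finset.mem_insert.1 this with h1 | h1
    · exact h (Subtype.ext h1.symm)
    · exact i'.2 (Finset.mem_singleton.1 h1)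

/-- `p = 1`: if `0 ≠ v ∈ V` then `dim 𝒳(1,n)(V) ≥ n − 1` (the vectors `L_{eᵢ} v = eᵢ ∧ v` span an
`(n−1)`-dimensional space). [cite: DerksenMakam2018, Example 1.1, p. 2] locator: paper:arxiv-1606.06701 p0003.txt:L9 -/
theorem le_finrank_imageSubspace_extMul_one {n : ℕ} {V : Submodule K (ExtIdx n 1 → K)}
    {v : ExtIdx n 1 → K} (hv : v ∈ V) (hv0 : v ≠ 0) :
    n - 1 ≤ Module.finrank K (imageSubspace (Set.range (extMulMatrix K n 1)) V) := by
  classical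
  obtain ⟨S₀, hS₀⟩ := Function.ne_iff.1 hv0
  obtain ⟨s₀, hs₀⟩ := Finset.card_eq_one.1 S₀.2
  have hS₀' : S₀ = ⟨{s₀}, Finset.card_singleton s₀⟩ := Subtype.ext hs₀
  rw [hS₀'] at hS₀
  have hrange : LinearMap.range (Matrix.of fun (T : ExtIdx n 2) (i : Fin n) => (extMulMatrix K n 1 i).mulVec v T).mulVecLin ≤
      imageSubspace (Set.range (extMulMatrix K n 1)) V := by
    rintro _ ⟨u, rfl⟩
    exact wedgeWith_mulVec_mem hv u
  refine le_trans ?_ (Submodule.finrank_mono hrange)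
  change n - 1 ≤ (Matrix.of fun (T : ExtIdx n 2) (i : Fin n) => (extMulMatrix K n 1 i).mulVec v T).rank
  have h := Matrix.rank_submatrix_le (Matrix.of fun (T : ExtIdx n 2) (i : Fin n) => (extMulMatrix K n 1 i).mulVec v T)
    (fun i : {i : Fin n // i ≠ s₀} => (⟨{i.1, s₀}, Finset.card_pair i.2⟩ : ExtIdx n 2))
    (fun i : {i : Fin n // i ≠ s₀} => i.1)
  have hne : ∀ i : {i : Fin n // i ≠ s₀},
      wedgeSign K i.1 {s₀} * v ⟨{s₀}, Finset.card_singleton s₀⟩ ≠ 0 := fun i h0 => by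
    rcases mul_eq_zero.1 h0 with h0 | h0
    · simpa [h0] using wedgeSign_mul_self (R := K) i.1 ({s₀} : Finset (Fin n))
    · exact hS₀ h0
  have hcard : Fintype.card {i : {i : Fin n // i ≠ s₀} //
      wedgeSign K i.1 {s₀} * v ⟨{s₀}, Finset.card_singleton s₀⟩ ≠ 0} = n - 1 := by
    rw [Fintype.card_of_subtype Finset.univ fun i => ⟨fun _ => hne i, fun _ => Finset.mem_univ _⟩,
      Finset.card_univ, Fintype.card_subtype_compl, Fintype.card_fin, Fintype.card_unique]
  rw [wedgeWith_submatrix_eq_diagonal, Matrix.rank_diagonal, hcard] at h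
  exact h

/-- **[DM16, Cor 1.16(1)] at `i = 1` / [DM16, Example 1.1]: `ncrk 𝒳(1,n) = n` is full for `n ≥ 3`,
over EVERY field, PROVED** (no shrunk subspace: `codim V + dim 𝒳V ≥ n` by the bound
`dim 𝒳V ≥ n − 1` for `V ≠ 0, ⊤`, and `𝒳(1,n)(F^n) = Λ²`). With `rk 𝒳(1,n) = n − 1`
(`matrixSetRank_dmSpace`) this is the classical gap `crk < ncrk` of the generic skew-symmetric matrix.
[cite: DerksenMakam2018, Cor 1.16, p. 4] locator: paper:arxiv-1606.06701 p0004.txt:L51 -/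
theorem ncRank_dmSpace_one {n : ℕ} (hn : 3 ≤ n) :
    ncRank (dmSpace K n 1 : Set (Matrix (ExtIdx n 2) (ExtIdx n 1) K)) = n := by
  rw [ncRank_dmSpace]
  refine le_antisymm ((ncRank_le_card_cols _).trans (by rw [card_extIdx, Nat.choose_one_right])) ?_
  obtain ⟨V, hV⟩ := exists_shrunkCost_eq_ncRank (Set.range (extMulMatrix K n 1))
  rw [← hV, shrunkCost]
  have hq := Submodule.finrank_quotient_add_finrank V
  rw [Module.finrank_fintype_fun_eq_card, card_extIdx, Nat.choose_one_right] at hq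
  rcases eq_or_ne V ⊥ with rfl | hV0
  · rw [finrank_bot] at hq
    omega
  · obtain ⟨v, hv, hv0⟩ := (Submodule.ne_bot_iff V).1 hV0
    rcases eq_or_ne V ⊤ with rfl | hVtop
    · have htop : Module.finrank K (⊤ : Submodule K (ExtIdx n 1 → K)) = n := by
        rw [finrank_top, Module.finrank_fintype_fun_eq_card, card_extIdx, Nat.choose_one_right]
      have hq0 : Module.finrank K ((ExtIdx n 1 → K) ⧸ (⊤ : Submodule K (ExtIdx n 1 → K))) = 0 := by
        omega
      rw [imageSubspace_range_extMulMatrix_top, finrank_top, Module.finrank_fintype_fun_eq_card,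
        card_extIdx, hq0, zero_add]
      obtain ⟨m, rfl⟩ : ∃ m, n = m + 2 := ⟨n - 2, by omega⟩
      have h2 : (m + 2).choose (1 + 1) = (m + 1).choose 1 + (m + 1).choose (1 + 1) :=
        Nat.choose_succ_succ' (m + 1) 1
      rw [Nat.choose_one_right] at h2
      have h3 : 1 ≤ (m + 1).choose (1 + 1) := Nat.choose_pos (by omega)
      omega
    · have h1 := le_finrank_imageSubspace_extMul_one hv hv0
      have hlt : Module.finrank K V < n := by
        by_contra hge
        apply hVtop
        apply Submodule.eq_top_of_finrank_eq
        rw [Module.finrank_fintype_fun_eq_card, card_extIdx, Nat.choose_one_right]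
        have := hq
        omega
      omega

/-- **[DM16, Theorem 1.15] at `p = 1`, PROVED unconditionally**: `ncrk 𝒳(1,3) / rk 𝒳(1,3) = 3/2`.
[cite: DerksenMakam2018, Thm 1.15, p. 4] locator: paper:arxiv-1606.06701 p0004.txt:L42 -/
theorem DerksenMakam2018_thm_1_15_one [CharZero K] : DerksenMakam2018_thm_1_15 K 1 :=
  (DerksenMakam2018_thm_1_15_iff 1).2 (ncRank_dmSpace_one le_rfl)

/-- **An unconditional linear matrix with `rk_{F(x)} = 2 < 3 = hrk`, over every field** — the
`3 × 3` generic skew-symmetric matrix `A(1,3)` of [DM16, Example 1.1] (relabelled square): the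
`ε = 1/2` instance of [EGOW18, §6 bullet 4], kernel-checked without any named fact.
[cite: EfremenkoGargOliveiraWigderson2018, §6, p. 17] locator: paper:arxiv-1710.09502 p0017.txt:L20 -/
theorem EGOW2018_sec6_linearMatrix_hrk_three_rk_two (F : Type*) [Field F] :
    ∃ M : Matrix (Fin 3) (Fin 3) (MvPolynomial (Fin 3) F),
      (∀ i j, (M i j).IsHomogeneous 1) ∧ symbolicRank M = 2 ∧ homogRank M = 3 := by
  have h1 : symbolicRank (genericCombination (dmSquareFamily F 1)) = (2 * 1).choose 1 :=
    symbolicRank_genericCombination_dmSquareFamily 1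
  have h2 : homogRank (genericCombination (dmSquareFamily F 1)) = 2 * 1 + 1 := by
    rw [homogRank_genericCombination_eq_ncRank, ncRank_range_dmSquareFamily, ncRank_dmSpace_one le_rfl]
  exact ⟨genericCombination (dmSquareFamily F 1), isHomogeneous_genericCombination _, h1, h2⟩

end DegreeOne

end Literature.Computability.AlgebraicComplexity
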